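import Literature.NumberTheory.NumberFields.AmbiguousClassIndexFormula
import Literature.NumberTheory.NumberFields.HilbertTheorem92
import Literature.NumberTheory.NumberFields.NarrowClassGroup
import HarnessLib

/-!
# Hilbert 90 with signatures: in a cyclic extension a TOTALLY POSITIVE element of norm `1` is `σb/b` with `b` totally positive
# (`H¹(G, L⁺) = 0`), and the cohomology of the totally positive units `E⁺` (`#Ĥ⁻¹`, `#Ĥ⁰`, Herbrand quotient = that of `E`)

Topic `NumberTheory/NumberFields`; namespace `Literature.NumberTheory.NumberFields.AmbiguousClass` (that of the tree's Chevalley formula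
files).  THEOREM-ONLY file (no definition, no named fact, no instance, no `sorry`), written by the prover seat
`cruxlead-stmt-BirchSwinnertonDyer-19573-w2` GEN 12 (cell `bsd-2adic`; `--supports` stmt-BirchSwinnertonDyer-19573; closes nothing).  Part I of
the NARROW ambiguous class number formula (`AmbiguousNarrowClassNumberFormula.lean`): everything that happens inside `Lˣ`.

Notation (tree currency, inside `Lˣ` with the Galois action of `CyclicNormIndex`/`MinkowskiUnits`): `L⁺ = ker(signHom L)` (totally
positive elements, Fröhlich–Taylor's `N₊`), `E = unitsE L` (`𝓞_Lˣ`), `E⁺ = E ⊓ L⁺`, `K⁺ ↪ L⁺` the image of `ker(signHom K)` under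
`unitsIncl K L`, `E_K⁺ = E⁺ ⊓ Kˣ`, `N = N_G = Herbrand.norm`, `σ − 1 = Herbrand.twist σ`, `G = Gal(L/K) = ⟨σ⟩`.

* §0 `L⁺`, `E⁺` are `G`-stable; `K⁺ ≤ L⁺`; under `IsUnramifiedAtInfinitePlaces K L` every real embedding of `K` extends to a real embedding
  of `L` (`exists_realEmbedding_comp_eq_of_isUnramifiedAtInfinitePlaces`; e.g. `L` totally real, `isUnramifiedAtInfinitePlaces_of_isTotallyReal`);
  `G` is transitive on the real embeddings of `L` above one of `K` (`exists_realEmbedding_comp_algEquiv_eq`, Mathlib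
  `ComplexEmbedding.exists_comp_symm_eq_of_comp_eq`).
* §1 ★ **`H¹(G, L⁺) = 0`** (`exists_mem_ker_signHom_smul_div_eq`): `a ∈ L⁺`, `N_G a = 1` ⟹ `a = σb/b` with `b ∈ L⁺`.  Hilbert 90 gives `b₀`;
  `a > 0` forces `sign ψ(σb₀) = sign ψ(b₀)` at every real `ψ`, so the signs of `b₀` are constant on `G`-orbits of real embeddings
  (`realEmbedding_smul_neg_iff_of_twist_mem_ker_signHom`), i.e. on the fibres over `K`; weak approximation in `K` (`signHom_surjective`) gives
  `c ∈ Kˣ` with these signs and `b = b₀/c` works.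
* §2 `(σ − 1){a ∈ L⁺ : σa/a ∈ E⁺} = {e ∈ E⁺ : N e = 1}` and **`[{a ∈ L⁺ : σa/a ∈ E⁺} : K⁺E⁺] = #Ĥ⁻¹(G, E⁺)`** (unramified at `∞`:
  `Kˣ ∩ L⁺ = K⁺`); `#Ĥ⁰(G, E⁺) = [E_K⁺ : N E⁺] = [E_K⁺ ∩ N L⁺ : N E⁺] · [E_K⁺ : E_K⁺ ∩ N L⁺]`.
* §3 **Herbrand quotient of `E⁺` = that of `E`**: `#Ĥ⁻¹(G, E⁺) = [L:K] · #Ĥ⁰(G, E⁺) ≠ 0` for `L/K` unramified at `∞` (tree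
  `h1_unitsE_eq_finrank_mul_h0` for `E` + Childress Cor. 4.4 `h0_mul_h1_eq_of_relIndex_ne_zero` along the finite-index `E⁺ ≤ E`).

References: [Yu2014AmbiguousClassNumberFormulas] C.-F. Yu, *Ambiguous class number formulas*, arXiv:1412.1458, Thm. 1.1 and proof (held, pp. 3–4);
[Gras2003] II.6.2.3, IV.4; [Lang1990] Ch. 13 §4 Lemma 4.1 (PDF pp. 203–204); [NeukirchANT1999] Ch. IV §3 (3.5); [FrohlichTaylor1990] Ch. II (2.14),
Ch. V §1 (1.8)–(1.13); [Childress2009] Ch. 4 §4 Cor. 4.4, §5 Prop. 5.10.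
-/

noncomputable section

open NumberField NumberField.InfinitePlace IsDedekindDomain FractionalIdeal
open scoped nonZeroDivisors Pointwise

namespace Literature.NumberTheory.NumberFields.AmbiguousClass

open Literature.NumberTheory.GaloisRepresentations Literature.NumberTheory.GaloisRepresentations.Herbrand
  Literature.NumberTheory.GaloisRepresentations.MinkowskiUnit
  Literature.NumberTheory.GaloisRepresentations.CyclicNormIndex

/-! ### Index bookkeeping -/

section Group

variable {G H : Type*} [Group G] [Group H]

/-- If `B ≤ A` and `ker f ∩ A ≤ B` then `[f(A) : f(B)] = [A : B]` (the private lemma of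
`AmbiguousClassIndexFormula.lean` / `HilbertTheorem94.lean`, made available to the narrow files). [folklore] -/
private theorem relIndex_map_map_of_ker_inf_le (f : G →* H) {A B : Subgroup G} (hBA : B ≤ A)
    (hker : f.ker ⊓ A ≤ B) : (B.map f).relIndex (A.map f) = B.relIndex A := by
  have hX : (B.map f).comap f ⊓ A = B ⊓ A := by
    ext x
    simp only [Subgroup.mem_inf, Subgroup.mem_comap, Subgroup.mem_map]
    constructor
    · rintro ⟨⟨b, hb, hbx⟩, hxA⟩
      have hk : x * b⁻¹ ∈ f.ker ⊓ A :=
        Subgroup.mem_inf.mpr ⟨by rw [MonoidHom.mem_ker, map_mul, map_inv, ← hbx, mul_inv_cancel],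
          A.mul_mem hxA (A.inv_mem (hBA hb))⟩
      have := B.mul_mem (hker hk) hb
      rw [inv_mul_cancel_right] at this
      exact ⟨this, hxA⟩
    · rintro ⟨hxB, hxA⟩
      exact ⟨⟨x, hxB, rfl⟩, hxA⟩
  rw [← Subgroup.relIndex_comap, ← Subgroup.inf_relIndex_right ((B.map f).comap f), hX,
    Subgroup.inf_relIndex_right]

end Group

variable {K L : Type} [Field K] [NumberField K] [Field L] [NumberField L] [Algebra K L]

/-! ### §0 The totally positive elements `L⁺` and units `E⁺` under the Galois action; real embeddings -/

omit [NumberField K] [NumberField L] in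
/-- A real embedding composed with an automorphism, on the values of the Galois action on `Lˣ`:
`ψ(g • x) = (ψ ∘ g)(x)`. [folklore] -/
private theorem realEmbedding_smul_units (ψ : L →+* ℝ) (g : L ≃ₐ[K] L) (x : Lˣ) :
    ψ ((g • x : Lˣ) : L) = (ψ.comp (g : L →+* L)) (x : L) := rfl

omit [NumberField K] [NumberField L] in
/-- **`L⁺ = ker(signHom L)` is `Gal(L/K)`-stable**: `ψ(g a) = (ψ ∘ g)(a) > 0` for every real embedding `ψ`.
[cite: FrohlichTaylor1990, Ch. V §1 (N₊), p. 163] -/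
theorem isStable_ker_signHom : IsStable (L ≃ₐ[K] L) (signHom L).ker := by
  intro g a ha
  rw [mem_ker_signHom_iff] at ha ⊢
  intro ψ
  rw [realEmbedding_smul_units]
  exact ha _

omit [NumberField K] [NumberField L] in
/-- `E⁺ = 𝓞_Lˣ ∩ L⁺` is `Gal(L/K)`-stable. [cite: FrohlichTaylor1990, Ch. V §1 (U_N⁺), p. 163] -/
theorem isStable_unitsE_inf_ker_signHom : IsStable (L ≃ₐ[K] L) (unitsE L ⊓ (signHom L).ker) :=
  isStable_unitsE.inf isStable_ker_signHom

omit [NumberField K] [NumberField L] in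
/-- A totally positive element of `K` is totally positive in `L` (a real embedding of `L` restricts to one of `K`).
[cite: FrohlichTaylor1990, Ch. V §1, p. 163] -/
theorem map_unitsIncl_ker_signHom_le : ((signHom K).ker).map (unitsIncl K L) ≤ (signHom L).ker := by
  rintro _ ⟨k, hk, rfl⟩
  rw [SetLike.mem_coe, mem_ker_signHom_iff] at hk
  rw [mem_ker_signHom_iff]
  intro ψ
  rw [coe_unitsIncl]
  exact hk (ψ.comp (algebraMap K L))

/-- **Unramified at infinity: every real embedding of `K` extends to a real embedding of `L`.**  Lift `ρ` to `Φ : L → ℂ`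
(Mathlib `ComplexEmbedding.lift`); the place of `Φ` lies over the real place of `ρ` and is unramified, hence real, so `Φ` is real.
[cite: Lang1990, Ch. 13 §4 (archimedean `e(v)`) (PDF p. 203)] -/
theorem exists_realEmbedding_comp_eq_of_isUnramifiedAtInfinitePlaces [IsUnramifiedAtInfinitePlaces K L] (ρ : K →+* ℝ) :
    ∃ ψ : L →+* ℝ, ψ.comp (algebraMap K L) = ρ := by
  set φ : K →+* ℂ := Complex.ofRealHom.comp ρ with hφ
  have hφreal : ComplexEmbedding.IsReal φ := isReal_ofRealHom_comp K ρ
  set Φ : L →+* ℂ := ComplexEmbedding.lift L φ with hΦ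
  have hΦK : Φ.comp (algebraMap K L) = φ := ComplexEmbedding.lift_comp_algebraMap L φ
  have hw : (InfinitePlace.mk Φ).comap (algebraMap K L) = InfinitePlace.mk φ := by rw [comap_mk, hΦK]
  have hΦreal : ComplexEmbedding.IsReal Φ := by
    rcases isUnramified_iff.mp ((InfinitePlace.mk Φ).isUnramified K) with h | h
    · exact isReal_mk_iff.mp h
    · rw [hw, isComplex_mk_iff] at h; exact absurd hφreal h
  refine ⟨hΦreal.embedding, ?_⟩
  ext x
  apply Complex.ofReal_injective
  rw [RingHom.comp_apply, ComplexEmbedding.IsReal.coe_embedding_apply hΦreal, ← RingHom.comp_apply, hΦK, hφ]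
  rfl

omit [NumberField K] [NumberField L] in
/-- `L` totally real ⟹ `L/K` is unramified at the infinite places (every infinite place of `L` is real, `e(v) = 1`).
[cite: Lang1990, Ch. 13 §4 (archimedean ramification indices `e(v) = 1 or 2`) (PDF p. 203)] -/
theorem isUnramifiedAtInfinitePlaces_of_isTotallyReal [IsTotallyReal L] : IsUnramifiedAtInfinitePlaces K L :=
  ⟨fun w => isUnramified_iff.mpr (Or.inl (IsTotallyReal.isReal w))⟩

omit [NumberField K] [NumberField L] in
/-- **Transitivity of `Gal(L/K)` on the real embeddings of `L` above a real embedding of `K`**: two real embeddings with the same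
restriction to `K` differ by an automorphism (Mathlib `ComplexEmbedding.exists_comp_symm_eq_of_comp_eq`, `L/K` Galois).
[cite: Lang1990, Ch. 13 §4 (archimedean places in a Galois extension) (PDF p. 203)] -/
theorem exists_realEmbedding_comp_algEquiv_eq [IsGalois K L] {ψ ψ' : L →+* ℝ}
    (h : ψ.comp (algebraMap K L) = ψ'.comp (algebraMap K L)) :
    ∃ τ : L ≃ₐ[K] L, ψ.comp (τ : L →+* L) = ψ' := by
  obtain ⟨τ, hτ⟩ := NumberField.ComplexEmbedding.exists_comp_symm_eq_of_comp_eq (Complex.ofRealHom.comp ψ)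
    (Complex.ofRealHom.comp ψ') (by rw [RingHom.comp_assoc, RingHom.comp_assoc, h])
  refine ⟨τ.symm, ?_⟩
  ext x
  apply Complex.ofReal_injective
  have := RingHom.congr_fun hτ x
  simpa using this

/-! ### §1 `H¹(G, L⁺) = 0`: a totally positive element of norm `1` is `σb/b` with `b` totally positive -/

omit [NumberField K] [NumberField L] in
/-- The sign of `b` at the real embeddings is constant on `G`-orbits as soon as `σb/b` is totally positive:
`ψ(g b) < 0 ↔ ψ(b) < 0` for every `g ∈ G = ⟨σ⟩` and every real `ψ` (induction on `g = σ^i`, with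
`ψ(σ^{i+1} b) = (ψ ∘ σ)(σ^i b)`). [cite: FrohlichTaylor1990, Ch. V §1 (1.11), p. 164] -/
theorem realEmbedding_smul_neg_iff_of_twist_mem_ker_signHom [Fintype (L ≃ₐ[K] L)] {σ : L ≃ₐ[K] L}
    (hσ : ∀ τ : L ≃ₐ[K] L, τ ∈ Subgroup.zpowers σ) {b : Lˣ} (hb : σ • b / b ∈ (signHom L).ker)
    (g : L ≃ₐ[K] L) (ψ : L →+* ℝ) : ψ ((g • b : Lˣ) : L) < 0 ↔ ψ (b : L) < 0 := by
  have step : ∀ χ : L →+* ℝ, χ ((σ • b : Lˣ) : L) < 0 ↔ χ (b : L) < 0 := by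
    intro χ
    have hpos := (mem_ker_signHom_iff L).mp hb χ
    rw [Units.val_div_eq_div_val, map_div₀] at hpos
    have hb0 : χ (b : L) ≠ 0 := embedding_units_ne_zero L χ b
    rcases div_pos_iff.mp hpos with ⟨h1, h2⟩ | ⟨h1, h2⟩
    · exact ⟨fun h => absurd h (not_lt.mpr h1.le), fun h => absurd h (not_lt.mpr h2.le)⟩
    · exact ⟨fun _ => h2, fun _ => h1⟩
  obtain ⟨i, rfl⟩ := Herbrand.exists_pow_eq_of_forall_mem_zpowers hσ g
  induction i generalizing ψ with
  | zero => rw [pow_zero, one_smul]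
  | succ i ih =>
    rw [pow_succ', mul_smul, realEmbedding_smul_units ψ σ]
    refine (ih (ψ.comp (σ : L →+* L))).trans ?_
    rw [← realEmbedding_smul_units ψ σ b]
    exact step ψ

/-- **`H¹(G, L⁺) = 0`** for `L/K` cyclic (Galois, `Gal = ⟨σ⟩`): a TOTALLY POSITIVE `a ∈ Lˣ` with `N_G a = 1` is `σ • b / b` for some
TOTALLY POSITIVE `b`.  Hilbert 90 gives `b₀`; by `realEmbedding_smul_neg_iff_of_twist_mem_ker_signHom` the signs of `b₀` are constant on
the `G`-orbits of real embeddings, i.e. (transitivity, `exists_realEmbedding_comp_algEquiv_eq`) depend only on the restriction to `K`;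
weak approximation in `K` (`signHom_surjective`) gives `c ∈ Kˣ` with these signs, and `b = b₀ / c` is totally positive with
`σb/b = σb₀/b₀ = a` (`σc = c`).
[cite: Yu2014AmbiguousClassNumberFormulas, Thm. 1.1 (narrow case) and its proof] [cite: NeukirchANT1999, Ch. IV §3 Thm. (3.5) (Hilbert 90)]
[cite: FrohlichTaylor1990, Ch. II (2.14), Ch. V §1 (1.11)] -/
theorem exists_mem_ker_signHom_smul_div_eq [IsGalois K L] {σ : L ≃ₐ[K] L}
    (hσ : ∀ τ : L ≃ₐ[K] L, τ ∈ Subgroup.zpowers σ) {a : Lˣ} (ha : a ∈ (signHom L).ker)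
    (hN : Herbrand.norm (L ≃ₐ[K] L) a = 1) : ∃ b ∈ (signHom L).ker, σ • b / b = a := by
  classical
  -- Hilbert 90
  have hN' : normEnd σ (Nat.card (L ≃ₐ[K] L)) a = 1 := by
    rw [normEnd_apply, prod_range_card_pow_eq_prod hσ (fun g => g • a), ← norm_apply, hN]
  obtain ⟨b₀, hb₀⟩ := exists_smul_div_eq_of_normEnd_eq_one hσ hN'
  have hsign : ∀ (g : L ≃ₐ[K] L) (ψ : L →+* ℝ), ψ ((g • b₀ : Lˣ) : L) < 0 ↔ ψ (b₀ : L) < 0 :=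
    realEmbedding_smul_neg_iff_of_twist_mem_ker_signHom hσ (by rw [hb₀]; exact ha)
  -- the sign of `b₀` at `ψ` depends only on `ψ|_K`
  have hconst : ∀ ψ ψ' : L →+* ℝ, ψ.comp (algebraMap K L) = ψ'.comp (algebraMap K L) →
      (ψ (b₀ : L) < 0 ↔ ψ' (b₀ : L) < 0) := by
    intro ψ ψ' h
    obtain ⟨τ, rfl⟩ := exists_realEmbedding_comp_algEquiv_eq h
    rw [← realEmbedding_smul_units ψ τ b₀]
    exact (hsign τ ψ).symm
  -- the sign vector on `K` and an element `c ∈ Kˣ` realising it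
  set t : (K →+* ℝ) → ZMod 2 := fun ρ =>
    if ∃ ψ : L →+* ℝ, ψ.comp (algebraMap K L) = ρ ∧ ψ (b₀ : L) < 0 then 1 else 0 with ht
  obtain ⟨c, hc⟩ := signHom_surjective K (Multiplicative.ofAdd t)
  have hc' : ∀ ρ : K →+* ℝ, ρ (c : K) < 0 ↔ ∃ ψ : L →+* ℝ, ψ.comp (algebraMap K L) = ρ ∧ ψ (b₀ : L) < 0 := by
    intro ρ
    have h1 := signHom_apply K c ρ
    rw [hc, toAdd_ofAdd, ht] at h1
    by_cases hex : ∃ ψ : L →+* ℝ, ψ.comp (algebraMap K L) = ρ ∧ ψ (b₀ : L) < 0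
    · simp only [hex, if_true] at h1
      refine ⟨fun _ => hex, fun _ => ?_⟩
      by_contra hnot
      rw [if_neg hnot] at h1
      exact one_ne_zero h1
    · simp only [hex, if_false] at h1
      refine ⟨fun hlt => ?_, fun h => absurd h hex⟩
      rw [if_pos hlt] at h1
      exact absurd h1.symm one_ne_zero
  refine ⟨b₀ / unitsIncl K L c, ?_, ?_⟩
  · -- `b₀ / c` is totally positive
    rw [mem_ker_signHom_iff]
    intro ψ
    rw [Units.val_div_eq_div_val, map_div₀, coe_unitsIncl, ← RingHom.comp_apply]
    have hb0 : ψ (b₀ : L) ≠ 0 := embedding_units_ne_zero L ψ b₀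
    have hc0 : (ψ.comp (algebraMap K L)) (c : K) ≠ 0 := embedding_units_ne_zero K _ c
    by_cases hneg : ψ (b₀ : L) < 0
    · have hcneg : (ψ.comp (algebraMap K L)) (c : K) < 0 := (hc' _).mpr ⟨ψ, rfl, hneg⟩
      exact div_pos_of_neg_of_neg hneg hcneg
    · have hbpos : 0 < ψ (b₀ : L) := lt_of_le_of_ne (not_lt.mp hneg) hb0.symm
      have hcpos : 0 < (ψ.comp (algebraMap K L)) (c : K) := by
        refine lt_of_le_of_ne (not_lt.mp fun hlt => ?_) hc0.symm
        obtain ⟨ψ', hψ', hneg'⟩ := (hc' _).mp hlt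
        exact hneg ((hconst ψ' ψ hψ').mp hneg')
      exact div_pos hbpos hcpos
  · rw [smul_div', smul_unitsIncl, div_div_div_cancel_right, hb₀]

/-! ### §2 `#Ĥ⁻¹(G, E⁺)` as the index `[{a ∈ L⁺ : σa/a ∈ E⁺} : K⁺E⁺]`, and `#Ĥ⁰(G, E⁺)` -/

/-- **`(σ − 1){a ∈ L⁺ : σa/a ∈ E⁺} = {e ∈ E⁺ : N e = 1}`**: `⊆` since `N ∘ (σ − 1) = 1`; `⊇` by §1 (`H¹(G, L⁺) = 0`: a totally
positive unit of norm `1` is `σb/b` with `b` totally positive).  Narrow twin of `map_twist_z0_unitsE_eq_z1`.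
[cite: NeukirchANT1999, Ch. IV §3 Thm. (3.5)] [cite: Yu2014AmbiguousClassNumberFormulas, Thm. 1.1 (proof)] -/
theorem map_twist_z0_kerSign_unitsPos_eq_z1 [IsGalois K L] {σ : L ≃ₐ[K] L}
    (hσ : ∀ τ : L ≃ₐ[K] L, τ ∈ Subgroup.zpowers σ) :
    (z0 σ (signHom L).ker (unitsE L ⊓ (signHom L).ker)).map (twist σ) =
      z1 (L ≃ₐ[K] L) (unitsE L ⊓ (signHom L).ker) ⊥ := by
  apply le_antisymm
  · rintro _ ⟨b, hb, rfl⟩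
    obtain ⟨-, he⟩ := mem_z0.mp hb
    exact mem_z1_bot.mpr ⟨he, norm_twist σ b⟩
  · intro e he
    obtain ⟨heE, hN⟩ := mem_z1_bot.mp he
    obtain ⟨b, hb, hbe⟩ := exists_mem_ker_signHom_smul_div_eq hσ heE.2 hN
    refine ⟨b, mem_z0.mpr ⟨hb, ?_⟩, hbe⟩
    rw [hbe]; exact heE

/-- **`[{a ∈ L⁺ : σa/a ∈ E⁺} : K⁺ · E⁺] = #Ĥ⁻¹(G, E⁺)`** (`L/K` cyclic, UNRAMIFIED AT INFINITY): the twist `σ − 1` maps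
`{a ∈ L⁺ : σa/a ∈ E⁺}` onto the norm-one elements of `E⁺` (`map_twist_z0_kerSign_unitsPos_eq_z1`) with kernel `Kˣ ∩ L⁺ = K⁺` (a
`k ∈ K` positive at every real place of `L` is totally positive in `K`, because every real embedding of `K` extends to `L` —
`exists_realEmbedding_comp_eq_of_isUnramifiedAtInfinitePlaces`), and `K⁺E⁺ ↦ (σ − 1)E⁺`.  Narrow twin of `relIndex_z0_unitsE_eq_h1`.
[cite: Lang1990, Ch. 13 §4, proof of Lemma 4.1, eq. (3) (PDF p. 204)] [cite: Yu2014AmbiguousClassNumberFormulas, Thm. 1.1 (proof)] -/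
theorem relIndex_z0_kerSign_unitsPos_eq_h1 [IsGalois K L] [IsUnramifiedAtInfinitePlaces K L] {σ : L ≃ₐ[K] L}
    (hσ : ∀ τ : L ≃ₐ[K] L, τ ∈ Subgroup.zpowers σ) :
    ((unitsE L ⊓ (signHom L).ker) ⊔ ((signHom K).ker).map (unitsIncl K L)).relIndex
        (z0 σ (signHom L).ker (unitsE L ⊓ (signHom L).ker)) = h1 σ (unitsE L ⊓ (signHom L).ker) ⊥ := by
  have htw : (twist σ : Lˣ →* Lˣ) = twistEnd σ := MonoidHom.ext fun _ => rfl
  have hker : (twist σ : Lˣ →* Lˣ).ker = (unitsIncl K L).range := by rw [htw, ker_twistEnd hσ]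
  -- `E⁺ ⊔ K⁺ ≤ z0`
  have hEle : unitsE L ⊓ (signHom L).ker ≤ z0 σ (signHom L).ker (unitsE L ⊓ (signHom L).ker) := fun e he =>
    mem_z0.mpr ⟨he.2, (unitsE L ⊓ (signHom L).ker).div_mem (isStable_unitsE_inf_ker_signHom σ he) he⟩
  have hKle : ((signHom K).ker).map (unitsIncl K L) ≤ z0 σ (signHom L).ker (unitsE L ⊓ (signHom L).ker) := by
    intro k hk
    have hk1 : twist σ k = 1 := by
      obtain ⟨k₀, -, rfl⟩ := hk
      rw [← MonoidHom.mem_ker, hker]; exact ⟨k₀, rfl⟩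
    refine mem_z0.mpr ⟨map_unitsIncl_ker_signHom_le hk, ?_⟩
    rw [← twist_apply, hk1]
    exact Subgroup.one_mem _
  have hle : (unitsE L ⊓ (signHom L).ker) ⊔ ((signHom K).ker).map (unitsIncl K L) ≤
      z0 σ (signHom L).ker (unitsE L ⊓ (signHom L).ker) := sup_le hEle hKle
  -- the kernel of the twist inside `z0 ≤ L⁺` is `K⁺`
  have hkerle : (twist σ : Lˣ →* Lˣ).ker ⊓ z0 σ (signHom L).ker (unitsE L ⊓ (signHom L).ker) ≤
      (unitsE L ⊓ (signHom L).ker) ⊔ ((signHom K).ker).map (unitsIncl K L) := by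
    intro k hk
    obtain ⟨hk1, hk2⟩ := Subgroup.mem_inf.mp hk
    rw [hker] at hk1
    obtain ⟨k₀, rfl⟩ := hk1
    have hpos := (mem_ker_signHom_iff L).mp (z0_le hk2)
    refine Subgroup.mem_sup_right ⟨k₀, ?_, rfl⟩
    rw [SetLike.mem_coe, mem_ker_signHom_iff]
    intro ρ
    obtain ⟨ψ, hψ⟩ := exists_realEmbedding_comp_eq_of_isUnramifiedAtInfinitePlaces (K := K) (L := L) ρ
    have := hpos ψ
    rwa [coe_unitsIncl, ← RingHom.comp_apply, hψ] at this
  rw [← relIndex_map_map_of_ker_inf_le (twist σ) hle hkerle, Subgroup.map_sup, map_twist_z0_kerSign_unitsPos_eq_z1 hσ,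
    h1_def, b1_bot]
  congr 1
  rw [sup_eq_left]
  rintro _ ⟨k, hk, rfl⟩
  have hk1 : twist σ k = 1 := by
    obtain ⟨k₀, -, rfl⟩ := hk
    rw [← MonoidHom.mem_ker, hker]; exact ⟨k₀, rfl⟩
  rw [hk1]; exact Subgroup.one_mem _

/-- **`#Ĥ⁰(G, E⁺) = [E_K⁺ : N_G(E⁺)]`** (inside `Lˣ`; `E_K⁺ = E⁺ ∩ Kˣ`): the `σ`-fixed elements of `E⁺` are those in `Kˣ`
(`ker(σ − 1) = Kˣ`). Narrow twin of `h0_unitsE_eq_relIndex`. [cite: Childress2009, Ch. 4 §4 (PDF p. 84)] -/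
theorem h0_unitsPos_eq_relIndex [IsGalois K L] {σ : L ≃ₐ[K] L}
    (hσ : ∀ τ : L ≃ₐ[K] L, τ ∈ Subgroup.zpowers σ) :
    h0 σ (unitsE L ⊓ (signHom L).ker) ⊥ =
      ((unitsE L ⊓ (signHom L).ker).map (Herbrand.norm (L ≃ₐ[K] L))).relIndex
        ((unitsE L ⊓ (signHom L).ker) ⊓ (unitsIncl K L).range) := by
  have hz : z0 σ (unitsE L ⊓ (signHom L).ker) ⊥ = (unitsE L ⊓ (signHom L).ker) ⊓ (unitsIncl K L).range := by
    ext e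
    rw [← ker_twistEnd hσ]
    simp only [mem_z0_bot, Subgroup.mem_inf, MonoidHom.mem_ker, twistEnd_apply, div_eq_one]
  rw [h0_def, b0_bot, hz]

/-- `N_G(E⁺) ≤ E⁺ ∩ N_G(L⁺) ≤ E⁺ ∩ Kˣ`: the inclusions `E_K⁺ ⊇ E_K⁺ ∩ N L⁺ ⊇ N E⁺` (norms are `G`-fixed, hence in `K`).
[cite: Lang1990, Ch. 13 §4, proof of Lemma 4.1 (PDF p. 204)] -/
theorem map_norm_unitsPos_le [IsGalois K L] {σ : L ≃ₐ[K] L}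
    (hσ : ∀ τ : L ≃ₐ[K] L, τ ∈ Subgroup.zpowers σ) :
    (unitsE L ⊓ (signHom L).ker).map (Herbrand.norm (L ≃ₐ[K] L)) ≤
        (unitsE L ⊓ (signHom L).ker) ⊓ ((signHom L).ker).map (Herbrand.norm (L ≃ₐ[K] L)) ∧
      (unitsE L ⊓ (signHom L).ker) ⊓ ((signHom L).ker).map (Herbrand.norm (L ≃ₐ[K] L)) ≤
        (unitsE L ⊓ (signHom L).ker) ⊓ (unitsIncl K L).range := by
  refine ⟨?_, inf_le_inf_left _ ((Subgroup.map_mono le_top).trans (map_norm_top_le_range_unitsIncl hσ))⟩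
  rintro _ ⟨e, he, rfl⟩
  exact ⟨isStable_unitsE_inf_ker_signHom.norm_mem he, ⟨e, he.2, rfl⟩⟩

/-- **`#Ĥ⁰(G, E⁺) = [E_K⁺ ∩ N L⁺ : N E⁺] · [E_K⁺ : E_K⁺ ∩ N L⁺]`.** [cite: Lang1990, Ch. 13 §4, proof of Lemma 4.1 (PDF p. 204)] -/
theorem h0_unitsPos_eq_relIndex_mul [IsGalois K L] {σ : L ≃ₐ[K] L}
    (hσ : ∀ τ : L ≃ₐ[K] L, τ ∈ Subgroup.zpowers σ) :
    h0 σ (unitsE L ⊓ (signHom L).ker) ⊥ =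
      ((unitsE L ⊓ (signHom L).ker).map (Herbrand.norm (L ≃ₐ[K] L))).relIndex
          ((unitsE L ⊓ (signHom L).ker) ⊓ ((signHom L).ker).map (Herbrand.norm (L ≃ₐ[K] L))) *
        ((unitsE L ⊓ (signHom L).ker) ⊓ ((signHom L).ker).map (Herbrand.norm (L ≃ₐ[K] L))).relIndex
          ((unitsE L ⊓ (signHom L).ker) ⊓ (unitsIncl K L).range) := by
  obtain ⟨h₁, h₂⟩ := map_norm_unitsPos_le hσ
  rw [h0_unitsPos_eq_relIndex hσ, Subgroup.relIndex_mul_relIndex _ _ _ h₁ h₂]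

/-! ### §3 The Herbrand quotient of `E⁺`: `[L : K] · #Ĥ⁰(G, E⁺) = #Ĥ⁻¹(G, E⁺)` (unramified at infinity) -/

omit [NumberField K] in
/-- `[E : E⁺] = #sign(E)` is finite (non-zero): `E⁺ = E ∩ ker(signHom)` and the signature group is finite.
[cite: FrohlichTaylor1990, Ch. V §1 (1.12), p. 164] -/
theorem relIndex_unitsPos_unitsE_ne_zero : (unitsE L ⊓ (signHom L).ker).relIndex (unitsE L) ≠ 0 := by
  rw [inf_comm, Subgroup.inf_relIndex_right, Subgroup.relIndex_ker]
  haveI : Finite ((unitsE L).map (signHom L)) := inferInstance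
  exact Nat.card_pos.ne'

/-- **The Herbrand quotient of the totally positive units is that of the units**: for `L/K` cyclic (`Gal = ⟨σ⟩`) UNRAMIFIED AT THE
INFINITE PLACES, `#Ĥ⁻¹(G, E⁺) = [L : K] · #Ĥ⁰(G, E⁺)` and `#Ĥ⁰(G, E⁺) ≠ 0` — from the same statement for `E`
(`h1_unitsE_eq_finrank_mul_h0`, Childress Prop. 5.10 with `2^a = 1`) and Childress Cor. 4.4 (`h0_mul_h1_eq_of_relIndex_ne_zero`: a
stable subgroup of finite index has the same Herbrand quotient). [cite: Childress2009, Ch. 4 §4 Cor. 4.4, §5 Prop. 5.10] -/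
theorem h1_unitsPos_eq_finrank_mul_h0 [IsGalois K L] [IsUnramifiedAtInfinitePlaces K L] {σ : L ≃ₐ[K] L}
    (hσ : ∀ τ : L ≃ₐ[K] L, τ ∈ Subgroup.zpowers σ) :
    h1 σ (unitsE L ⊓ (signHom L).ker) ⊥ = Module.finrank K L * h0 σ (unitsE L ⊓ (signHom L).ker) ⊥ ∧
      h0 σ (unitsE L ⊓ (signHom L).ker) ⊥ ≠ 0 := by
  haveI : FiniteDimensional K L := Module.Finite.of_restrictScalars_finite ℚ K L
  obtain ⟨hE, h0ne⟩ := h1_unitsE_eq_finrank_mul_h0 (K := K) (L := L) hσ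
  have hcor := h0_mul_h1_eq_of_relIndex_ne_zero (σ := σ) (C := (⊥ : Subgroup Lˣ)) isStable_unitsE
    isStable_unitsE_inf_ker_signHom IsStable.bot bot_le inf_le_left relIndex_unitsPos_unitsE_ne_zero
  -- `hcor : h0 E ⊥ * h1 E⁺ ⊥ = h0 E⁺ ⊥ * h1 E ⊥`
  rw [hE] at hcor
  have hmain : h1 σ (unitsE L ⊓ (signHom L).ker) ⊥ = Module.finrank K L * h0 σ (unitsE L ⊓ (signHom L).ker) ⊥ := by
    apply Nat.eq_of_mul_eq_mul_left (Nat.pos_of_ne_zero h0ne)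
    calc h0 σ (unitsE L) ⊥ * h1 σ (unitsE L ⊓ (signHom L).ker) ⊥
        = h0 σ (unitsE L ⊓ (signHom L).ker) ⊥ * (Module.finrank K L * h0 σ (unitsE L) ⊥) := hcor
      _ = h0 σ (unitsE L) ⊥ * (Module.finrank K L * h0 σ (unitsE L ⊓ (signHom L).ker) ⊥) := by ring
  refine ⟨hmain, fun hzero => ?_⟩
  have hne : h1 σ (unitsE L ⊓ (signHom L).ker) ⊥ ≠ 0 :=
    (h1_ne_zero_iff_of_relIndex_ne_zero (σ := σ) (C := (⊥ : Subgroup Lˣ)) isStable_unitsE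
      isStable_unitsE_inf_ker_signHom IsStable.bot bot_le inf_le_left relIndex_unitsPos_unitsE_ne_zero).mp
      (by rw [hE]; exact mul_ne_zero Module.finrank_pos.ne' h0ne)
  rw [hmain, hzero, mul_zero] at hne
  exact hne rfl

end Literature.NumberTheory.NumberFields.AmbiguousClass

end
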